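import Mathlib
import HarnessLib

/-!
# `FemtoCurvatureSkewness` — lattice momenta and slice masses (stub `TreeRatioFloor`, crux stmt-QuantumFields-9365)

The lattice momentum squared `k̂²(a) = 2 - 2cos(2πa/L)` on `ZMod L` (`eps`) and the slice masses
`μ(q) = k̂²(q₁) + k̂²(q₂)` (`mass`) of the `(k₀,k₁)`-slicing of the transverse torus propagator; the two-sided
bounds `16 d²/L² ≤ k̂²(a) ≤ 4π² d²/L²` (`d = a` or `L - a`), the termwise bounds
`(μ/16) e^{-mμ/8} ≤ μ 8^m/(μ+8)^{m+1} ≤ (μ/8) e^{-mμ/16}` on the terms of the mass weights of the lazy-walk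
expansion, and the Gaussian lattice sum bound `Σ_{d ≥ 1} e^{-a d²} ≤ 5 a^{-1/2}` (`a ≤ 1`).  Mathlib only.
-/

noncomputable section

namespace Summit.QuantumFields.YangMills.Theorems.FemtoCurvatureSkewness

open Finset
open scoped BigOperators

namespace TreeRatio

variable (L : ℕ)

/-- The lattice momentum squared `k̂²(a) = 2 - 2cos(2πa/L) ∈ [0, 4]`. -/
def eps (a : ZMod L) : ℝ := 2 - 2 * Real.cos (2 * Real.pi * (a.val : ℝ) / L)

/-- The slice mass `μ(q) = k̂²(q₁) + k̂²(q₂)`. -/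
def mass (q : ZMod L × ZMod L) : ℝ := eps L q.1 + eps L q.2

/-! ## Trigonometric bounds on `k̂²` -/

/-- `0 ≤ k̂²(a)`. -/
theorem eps_nonneg (a : ZMod L) : 0 ≤ eps L a := by
  unfold eps; have := Real.cos_le_one (2 * Real.pi * (a.val : ℝ) / L); linarith

/-- `k̂²(a) ≤ 4`. -/
theorem eps_le_four (a : ZMod L) : eps L a ≤ 4 := by
  unfold eps; have := Real.neg_one_le_cos (2 * Real.pi * (a.val : ℝ) / L); linarith

/-- `0 ≤ μ(q)`. -/
theorem mass_nonneg (q : ZMod L × ZMod L) : 0 ≤ mass L q := add_nonneg (eps_nonneg L q.1) (eps_nonneg L q.2)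

/-- `μ(q) ≤ 8`. -/
theorem mass_le_eight (q : ZMod L × ZMod L) : mass L q ≤ 8 := by
  have := eps_le_four L q.1; have := eps_le_four L q.2; unfold mass; linarith

/-- Jordan-type lower bound: `4x²/π² ≤ 2 - 2cos x` for `0 ≤ x ≤ π`. -/
theorem sq_le_two_sub_two_cos {x : ℝ} (h0 : 0 ≤ x) (hπ : x ≤ Real.pi) : 4 * x ^ 2 / Real.pi ^ 2 ≤ 2 - 2 * Real.cos x := by
  have hs : Real.sin (x / 2) ^ 2 = 1 / 2 - Real.cos x / 2 := by
    rw [Real.sin_sq_eq_half_sub, mul_div_cancel₀ _ two_ne_zero]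
  have hj : 2 / Real.pi * (x / 2) ≤ Real.sin (x / 2) := Real.mul_le_sin (by linarith) (by linarith)
  have hj0 : 0 ≤ 2 / Real.pi * (x / 2) := by positivity
  have hsq : (2 / Real.pi * (x / 2)) ^ 2 ≤ Real.sin (x / 2) ^ 2 := pow_le_pow_left₀ hj0 hj 2
  have hpi : 0 < Real.pi := Real.pi_pos
  calc 4 * x ^ 2 / Real.pi ^ 2 = 4 * (2 / Real.pi * (x / 2)) ^ 2 := by field_simp
    _ ≤ 4 * Real.sin (x / 2) ^ 2 := by gcongr
    _ = 2 - 2 * Real.cos x := by rw [hs]; ring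

/-- Upper bound near `0`: `k̂²(a) ≤ 4π² a²/L²` (with `a = a.val`). -/
theorem eps_le_sq (a : ZMod L) : eps L a ≤ 4 * Real.pi ^ 2 * (a.val : ℝ) ^ 2 / (L : ℝ) ^ 2 := by
  rcases Nat.eq_zero_or_pos L with hL | hL
  · subst hL; simp [eps]
  have hLr : (0 : ℝ) < L := by exact_mod_cast hL
  calc eps L a ≤ (2 * Real.pi * (a.val : ℝ) / L) ^ 2 := by
        have := Real.one_sub_sq_div_two_le_cos (x := 2 * Real.pi * (a.val : ℝ) / L); unfold eps; linarith
    _ = 4 * Real.pi ^ 2 * (a.val : ℝ) ^ 2 / (L : ℝ) ^ 2 := by field_simp; ring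

/-- `k̂²` is even on the circle: `k̂²(a)` only depends on `cos(2π(L - a)/L) = cos(2πa/L)`. -/
theorem cos_sub_val (a : ZMod L) (hL : 0 < L) :
    Real.cos (2 * Real.pi * ((L : ℝ) - a.val) / L) = Real.cos (2 * Real.pi * (a.val : ℝ) / L) := by
  have hLr : (L : ℝ) ≠ 0 := by exact_mod_cast hL.ne'
  rw [show 2 * Real.pi * ((L : ℝ) - a.val) / L = 2 * Real.pi - 2 * Real.pi * (a.val : ℝ) / L by field_simp,
    Real.cos_two_pi_sub]

/-- Upper bound near `L`: `k̂²(a) ≤ 4π² (L - a)²/L²`. -/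
theorem eps_le_sq' (a : ZMod L) (hL : 0 < L) : eps L a ≤ 4 * Real.pi ^ 2 * ((L : ℝ) - a.val) ^ 2 / (L : ℝ) ^ 2 := by
  have hLr : (0 : ℝ) < L := by exact_mod_cast hL
  unfold eps
  rw [← cos_sub_val L a hL]
  calc 2 - 2 * Real.cos (2 * Real.pi * ((L : ℝ) - a.val) / L) ≤ (2 * Real.pi * ((L : ℝ) - a.val) / L) ^ 2 := by
        have := Real.one_sub_sq_div_two_le_cos (x := 2 * Real.pi * ((L : ℝ) - a.val) / L); linarith
    _ = 4 * Real.pi ^ 2 * ((L : ℝ) - a.val) ^ 2 / (L : ℝ) ^ 2 := by field_simp; ring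

/-- Lower bound near `0`: `16 a²/L² ≤ k̂²(a)` when `2a ≤ L`. -/
theorem sq_le_eps (a : ZMod L) (hL : 0 < L) (ha : 2 * a.val ≤ L) : 16 * (a.val : ℝ) ^ 2 / (L : ℝ) ^ 2 ≤ eps L a := by
  have hLr : (0 : ℝ) < L := by exact_mod_cast hL
  have har : 2 * (a.val : ℝ) ≤ L := by exact_mod_cast ha
  have h0 : 0 ≤ 2 * Real.pi * (a.val : ℝ) / L := by positivity
  have hπ : 2 * Real.pi * (a.val : ℝ) / L ≤ Real.pi := by
    rw [div_le_iff₀ hLr]; nlinarith [Real.pi_pos]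
  have h := sq_le_two_sub_two_cos h0 hπ
  unfold eps
  calc 16 * (a.val : ℝ) ^ 2 / (L : ℝ) ^ 2 = 4 * (2 * Real.pi * (a.val : ℝ) / L) ^ 2 / Real.pi ^ 2 := by
        field_simp; ring
    _ ≤ 2 - 2 * Real.cos (2 * Real.pi * (a.val : ℝ) / L) := h

/-- Lower bound near `L`: `16 (L-a)²/L² ≤ k̂²(a)` when `L ≤ 2a`. -/
theorem sq_le_eps' (a : ZMod L) (hL : 0 < L) (ha : L ≤ 2 * a.val) :
    16 * ((L : ℝ) - a.val) ^ 2 / (L : ℝ) ^ 2 ≤ eps L a := by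
  haveI : NeZero L := ⟨hL.ne'⟩
  have hLr : (0 : ℝ) < L := by exact_mod_cast hL
  have har : (L : ℝ) ≤ 2 * a.val := by exact_mod_cast ha
  have hav : (a.val : ℝ) ≤ L := by exact_mod_cast (ZMod.val_lt a).le
  have h0 : 0 ≤ 2 * Real.pi * ((L : ℝ) - a.val) / L := by
    apply div_nonneg _ hLr.le; nlinarith [Real.pi_pos]
  have hπ : 2 * Real.pi * ((L : ℝ) - a.val) / L ≤ Real.pi := by
    rw [div_le_iff₀ hLr]; nlinarith [Real.pi_pos]
  have h := sq_le_two_sub_two_cos h0 hπ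
  unfold eps
  rw [← cos_sub_val L a hL]
  calc 16 * ((L : ℝ) - a.val) ^ 2 / (L : ℝ) ^ 2 = 4 * (2 * Real.pi * ((L : ℝ) - a.val) / L) ^ 2 / Real.pi ^ 2 := by
        field_simp; ring
    _ ≤ 2 - 2 * Real.cos (2 * Real.pi * ((L : ℝ) - a.val) / L) := h

/-! ## The terms of `D(m)` -/

/-- Each term of `D(m)` lies in `[0, 1]`: `0 ≤ μ 8^m/(μ+8)^{m+1}`. -/
theorem massD_term_nonneg (m : ℕ) (q : ZMod L × ZMod L) : 0 ≤ mass L q * 8 ^ m / (mass L q + 8) ^ (m + 1) := by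
  have := mass_nonneg L q; positivity

/-- Each term of `D(m)` lies in `[0, 1]`: `μ 8^m/(μ+8)^{m+1} ≤ 1`. -/
theorem massD_term_le_one (m : ℕ) (q : ZMod L × ZMod L) : mass L q * 8 ^ m / (mass L q + 8) ^ (m + 1) ≤ 1 := by
  have h0 := mass_nonneg L q
  have hpos : 0 < (mass L q + 8) ^ (m + 1) := by positivity
  rw [div_le_one hpos, pow_succ]
  have h8 : (8 : ℝ) ^ m ≤ (mass L q + 8) ^ m := pow_le_pow_left₀ (by norm_num) (by linarith) m
  nlinarith [pow_nonneg (show (0 : ℝ) ≤ 8 by norm_num) m]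

/-! ## A Gaussian lattice sum -/

/-- **Gaussian lattice sums**: `Σ_{d ≥ 1} e^{-a d²} ≤ 5 b` whenever `a b² = 1`, `b ≥ 1` (i.e. `b = a^{-1/2} ≥ 1`):
the first `⌈b⌉ ≤ 2b` terms are at most `1`, the others are dominated by the geometric series of ratio
`e^{-a⌈b⌉} ≤ e^{-1/b}`, of sum `≤ 1/(1 - e^{-1/b}) ≤ e b ≤ 3b`. -/
theorem sum_exp_neg_mul_sq_le {a b : ℝ} (ha : 0 < a) (hb : 1 ≤ b) (hab : a * b ^ 2 = 1) (N : ℕ) :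
    ∑ d ∈ range N, Real.exp (-a * ((d : ℝ) + 1) ^ 2) ≤ 5 * b := by
  set K : ℕ := ⌈b⌉₊ with hK
  have hbpos : 0 < b := by linarith
  have hKb : b ≤ K := Nat.le_ceil b
  have hK2 : (K : ℝ) ≤ 2 * b := by
    have := Nat.ceil_lt_add_one hbpos.le; rw [← hK] at this; linarith
  set ρ : ℝ := Real.exp (-a * K) with hρ
  have hρ0 : 0 ≤ ρ := (Real.exp_pos _).le
  have haK : 1 / b ≤ a * K := by
    rw [div_le_iff₀ hbpos]
    calc 1 = a * b ^ 2 := hab.symm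
      _ = a * b * b := by ring
      _ ≤ a * K * b := by gcongr
  have hρ1 : ρ ≤ Real.exp (-(1 / b)) := Real.exp_le_exp.mpr (by linarith)
  have hρlt : ρ < 1 := lt_of_le_of_lt hρ1 (Real.exp_lt_one_iff.mpr (by rw [neg_lt_zero]; positivity))
  -- `1 - e^{-x} ≥ x e^{-x} ≥ x/3` for `x = 1/b ≤ 1`
  have hgap : 1 / (3 * b) ≤ 1 - ρ := by
    have hx : 0 < 1 / b := by positivity
    have hx1 : 1 / b ≤ 1 := by rw [div_le_one hbpos]; exact hb
    have h1 : 1 / b * Real.exp (-(1 / b)) ≤ 1 - Real.exp (-(1 / b)) := by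
      have := Real.add_one_le_exp (1 / b)
      have hpos := Real.exp_pos (-(1 / b))
      have hmul : Real.exp (1 / b) * Real.exp (-(1 / b)) = 1 := by rw [← Real.exp_add]; simp
      nlinarith
    have h2 : Real.exp (-1) ≤ Real.exp (-(1 / b)) := Real.exp_le_exp.mpr (by linarith)
    have h3 : (1 : ℝ) / 3 ≤ Real.exp (-1) := by
      rw [Real.exp_neg, le_inv_comm₀ (by norm_num) (Real.exp_pos 1)]
      have := Real.exp_one_lt_d9; norm_num at this ⊢; linarith
    calc 1 / (3 * b) = (1 / b) * (1 / 3) := by ring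
      _ ≤ (1 / b) * Real.exp (-(1 / b)) := by gcongr; exact h3.trans h2
      _ ≤ 1 - Real.exp (-(1 / b)) := h1
      _ ≤ 1 - ρ := by linarith
  -- termwise domination by `1[d+1 ≤ K] + ρ^{d+1}`
  have hterm : ∀ d : ℕ, Real.exp (-a * ((d : ℝ) + 1) ^ 2) ≤ (if d + 1 ≤ K then (1 : ℝ) else 0) + ρ ^ (d + 1) := by
    intro d
    by_cases hd : d + 1 ≤ K
    · rw [if_pos hd]
      have h1 : Real.exp (-a * ((d : ℝ) + 1) ^ 2) ≤ 1 := Real.exp_le_one_iff.mpr (by nlinarith)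
      have h2 : 0 ≤ ρ ^ (d + 1) := by positivity
      linarith
    · rw [if_neg hd, zero_add, hρ, ← Real.exp_nat_mul]
      refine Real.exp_le_exp.mpr ?_
      have hdK : (K : ℝ) ≤ (d : ℝ) + 1 := by exact_mod_cast (show K ≤ d + 1 by omega)
      push_cast
      nlinarith [mul_nonneg ha.le (by positivity : (0 : ℝ) ≤ (d : ℝ) + 1)]
  calc ∑ d ∈ range N, Real.exp (-a * ((d : ℝ) + 1) ^ 2)
      ≤ ∑ d ∈ range N, ((if d + 1 ≤ K then (1 : ℝ) else 0) + ρ ^ (d + 1)) := sum_le_sum fun d _ => hterm d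
    _ = ∑ d ∈ range N, (if d + 1 ≤ K then (1 : ℝ) else 0) + ρ * ∑ d ∈ range N, ρ ^ d := by
        rw [sum_add_distrib, mul_sum]
        congr 1
        exact sum_congr rfl fun d _ => by ring
    _ ≤ K + ρ * (1 - ρ)⁻¹ := by
        gcongr
        · rw [← sum_filter]
          calc ∑ _d ∈ (range N).filter (fun d => d + 1 ≤ K), (1 : ℝ) = ((range N).filter (fun d => d + 1 ≤ K)).card := by
                simp
            _ ≤ (range K).card := by
                exact_mod_cast card_le_card (fun d hd => mem_range.mpr (by have := (mem_filter.mp hd).2; omega))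
            _ = K := by simp
        · have h := geom_sum_Ico_le_of_lt_one (m := 0) (n := N) hρ0 hρlt
          simpa using h
    _ ≤ 2 * b + 1 * (3 * b) := by
        have hinv : (1 - ρ)⁻¹ ≤ 3 * b := by
          rw [inv_le_comm₀ (by linarith) (by positivity)]
          calc (3 * b)⁻¹ = 1 / (3 * b) := (one_div _).symm
            _ ≤ 1 - ρ := hgap
        have hB : ρ * (1 - ρ)⁻¹ ≤ 1 * (3 * b) := mul_le_mul hρlt.le hinv (by positivity) zero_le_one
        linarith
    _ = 5 * b := by ring

/-! ## Termwise upper bounds -/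

/-- `(8/(μ+8))^m ≤ e^{-mμ/16}` for `0 ≤ μ ≤ 8`. -/
theorem ratio_pow_le_exp {μ : ℝ} (h0 : 0 ≤ μ) (h8 : μ ≤ 8) (m : ℕ) :
    (8 / (μ + 8)) ^ m ≤ Real.exp (-(m * μ) / 16) := by
  -- `e^{μ/16} ≤ 1 + μ/16 + (μ/16)² ≤ 1 + μ/8 = (μ+8)/8`
  have hu : |μ / 16| ≤ 1 := by rw [abs_of_nonneg (by positivity)]; linarith
  have hexp : Real.exp (μ / 16) ≤ (μ + 8) / 8 := by
    have h := Real.abs_exp_sub_one_sub_id_le hu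
    have h' := (abs_le.mp h).2
    nlinarith
  have hstep : 8 / (μ + 8) ≤ Real.exp (-(μ / 16)) := by
    rw [div_le_iff₀ (by linarith)]
    have hmul : Real.exp (-(μ / 16)) * Real.exp (μ / 16) = 1 := by rw [← Real.exp_add]; simp
    have h1 : 0 ≤ μ + 8 - 8 * Real.exp (μ / 16) := by linarith
    nlinarith [mul_nonneg (Real.exp_pos (-(μ / 16))).le h1]
  calc (8 / (μ + 8)) ^ m ≤ Real.exp (-(μ / 16)) ^ m := pow_le_pow_left₀ (by positivity) hstep m
    _ = Real.exp (-(m * μ) / 16) := by rw [← Real.exp_nat_mul]; ring_nf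

/-- Termwise: `μ 8^m/(μ+8)^{m+1} ≤ (μ/8) e^{-mμ/16}`. -/
theorem massD_term_le (m : ℕ) (q : ZMod L × ZMod L) :
    mass L q * 8 ^ m / (mass L q + 8) ^ (m + 1) ≤ mass L q / 8 * Real.exp (-(m * mass L q) / 16) := by
  have h0 := mass_nonneg L q
  have h8 := mass_le_eight L q
  have hpos : 0 < mass L q + 8 := by linarith
  calc mass L q * 8 ^ m / (mass L q + 8) ^ (m + 1) = mass L q / (mass L q + 8) * (8 / (mass L q + 8)) ^ m := by
        rw [pow_succ, div_pow]; field_simp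
    _ ≤ mass L q / 8 * Real.exp (-(m * mass L q) / 16) := by
        gcongr
        · linarith
        · exact ratio_pow_le_exp h0 h8 m

/-! ## Termwise lower bounds -/

/-- `e^{-mμ/8} ≤ (8/(μ+8))^m` for `μ ≥ 0`. -/
theorem exp_le_ratio_pow {μ : ℝ} (h0 : 0 ≤ μ) (m : ℕ) : Real.exp (-(m * μ) / 8) ≤ (8 / (μ + 8)) ^ m := by
  have hstep : Real.exp (-(μ / 8)) ≤ 8 / (μ + 8) := by
    rw [Real.exp_neg, le_div_iff₀ (by linarith)]
    have h := Real.add_one_le_exp (μ / 8)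
    have hpos := Real.exp_pos (μ / 8)
    calc (Real.exp (μ / 8))⁻¹ * (μ + 8) = 8 * ((μ / 8 + 1) / Real.exp (μ / 8)) := by field_simp
      _ ≤ 8 * 1 := by gcongr; rw [div_le_one hpos]; exact h
      _ = 8 := by ring
  calc Real.exp (-(m * μ) / 8) = Real.exp (-(μ / 8)) ^ m := by rw [← Real.exp_nat_mul]; ring_nf
    _ ≤ (8 / (μ + 8)) ^ m := pow_le_pow_left₀ (Real.exp_pos _).le hstep m

/-- Termwise from below: `(μ/16) e^{-mμ/8} ≤ μ 8^m/(μ+8)^{m+1}`. -/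
theorem le_massD_term (m : ℕ) (q : ZMod L × ZMod L) :
    mass L q / 16 * Real.exp (-(m * mass L q) / 8) ≤ mass L q * 8 ^ m / (mass L q + 8) ^ (m + 1) := by
  have h0 := mass_nonneg L q
  have h8 := mass_le_eight L q
  have hpos : 0 < mass L q + 8 := by linarith
  calc mass L q / 16 * Real.exp (-(m * mass L q) / 8) ≤ mass L q / (mass L q + 8) * (8 / (mass L q + 8)) ^ m := by
        gcongr
        · linarith
        · exact exp_le_ratio_pow h0 m
    _ = mass L q * 8 ^ m / (mass L q + 8) ^ (m + 1) := by rw [pow_succ, div_pow]; field_simp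

end TreeRatio

/-- **Gaussian lattice sum** (registered sub-goal `TreeRatioGaussLatticeSum`): `Σ_{d ≥ 1} e^{-a d²} ≤ 5 b` for `a b² = 1`, `b ≥ 1`. -/
theorem TreeRatioGaussLatticeSum : ∀ (a b : ℝ), 0 < a → 1 ≤ b → a * b ^ 2 = 1 → ∀ (N : ℕ), ∑ d ∈ Finset.range N, Real.exp (-a * ((d : ℝ) + 1) ^ 2) ≤ 5 * b :=
  fun _ _ ha hb hab N => TreeRatio.sum_exp_neg_mul_sq_le ha hb hab N

end Summit.QuantumFields.YangMills.Theorems.FemtoCurvatureSkewness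

end
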